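import Mathlib

/-!
# Shape packing for ordered escape ladders (support file)

Item `stmt-MatrixMultiplication-14308` (`FourierTwoFamiliesModP.PrimeTwoFamilies`, CKSU 2005
Conj. 4.7 with prime cyclic hosts), line Sketch, stub `ladder_sum_card_mul_card_le_of_subshape`.

A LADDER in an abelian group `G` is a family of `r` classes `(X c, Y c)`, `c : Fin r`, such that

* (`hW`) every class is direct: `(x - x') + (y - y') = 0` with `x, x' ∈ X c`, `y, y' ∈ Y c` forces
  `x = x'` and `y = y'`;
* (`hL`) for classes `p < q` every lower cross difference `y' - x'` (`x' ∈ X p`, `y' ∈ Y q`) avoids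
  every diagonal difference `y - x` (`x ∈ X c`, `y ∈ Y c`, any class `c`).

SHAPE PACKING (`ladder_sum_card_mul_card_le_of_subshape`, the one-directional analogue of the SDPP
engine `sum_card_mul_card_le_of_subshape` of `Theorems/PrimeTwoFamilies/Negative/Shapes.lean`): if a
translate `u c +ᵥ Y₀` of ONE pattern `Y₀` sits inside `Y c` for every `c ∈ S`, then
`(c, x, y₀) ↦ x + y₀` is injective on `(Σ_{c ∈ S} X c) × Y₀`, so `(Σ_{c ∈ S} |X c|) · |Y₀| ≤ |G|`.
Indeed a collision `x + y₀ = x' + y₀'` (`x ∈ X i`, `x' ∈ X k`) reads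
`(u_k + y₀) - x' = (u_k + y₀') - x`, a diagonal difference of class `k` equal to a cross difference
between `X i` and `Y k`: `hL` at `(k, i, k)` excludes `i < k`, `hL` at `(i, k, i)` excludes `k < i`,
and for `i = k` directness `hW` gives `x = x'`, `y₀ = y₀'`.

COROLLARY (`ladder_sum_card_mul_le_of_rightShapes`): if the `Y`-sides of a ladder are translates of
at most `K` templates, then `Σ_c |X c| |Y c| ≤ K · |G|` — near-apex ladders (`r ≈ m^{1/2}` classes
of co-volume `≈ m`) need `≈ m^{1/2}` pairwise NON-translate `Y`-sides.
-/

-- single-conjunct summit: the mandated namespace repeats `MatrixMultiplication` (summit = sub-problem).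
set_option linter.dupNamespace false

namespace Summit.MatrixMultiplication.MatrixMultiplication.Theorems.PrimeTwoFamilies.LadderLift

open Finset
open scoped Pointwise

-- adapted from `sum_card_mul_card_le_of_subshape` / `sum_card_mul_le_of_usesRightShapes` in the
-- tree file `Summits/MatrixMultiplication/MatrixMultiplication/Theorems/PrimeTwoFamilies/Negative/
-- Shapes.lean` (the SDPP versions).

/-- **A common translated sub-pattern packs (ladders).**  If `(X c, Y c)_{c < r}` is a ladder
(`hW`: every class direct; `hL`: lower cross differences avoid all diagonal differences) and a
translate `u c +ᵥ Y₀` of one pattern `Y₀` lies inside `Y c` for every `c ∈ S`, then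
`(c, x, y₀) ↦ x + y₀` is injective on `(Σ_{c ∈ S} X c) × Y₀`, so
`(Σ_{c ∈ S} |X c|) · |Y₀| ≤ |G|`. -/
theorem ladder_sum_card_mul_card_le_of_subshape {G : Type*} [AddCommGroup G] [Fintype G] [DecidableEq G]
    {r : ℕ} (X Y : Fin r → Finset G)
    (hW : ∀ c : Fin r, ∀ x ∈ X c, ∀ x' ∈ X c, ∀ y ∈ Y c, ∀ y' ∈ Y c,
      (x - x') + (y - y') = 0 → x = x' ∧ y = y')
    (hL : ∀ c p q : Fin r, p < q → ∀ x ∈ X c, ∀ y ∈ Y c, ∀ x' ∈ X p, ∀ y' ∈ Y q, y - x ≠ y' - x')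
    (S : Finset (Fin r)) (Y₀ : Finset G) (u : Fin r → G) (hY : ∀ c ∈ S, u c +ᵥ Y₀ ⊆ Y c) :
    (∑ c ∈ S, (X c).card) * Y₀.card ≤ Fintype.card G := by
  have memY : ∀ c ∈ S, ∀ b ∈ Y₀, u c + b ∈ Y c := fun c hc b hb =>
    hY c hc (Finset.mem_vadd_finset.2 ⟨b, hb, rfl⟩)
  let f : (Σ _ : Fin r, G) × G → G := fun z => z.1.2 + z.2
  have hinj : Set.InjOn f ↑((S.sigma fun c => X c) ×ˢ Y₀) := by
    rintro ⟨⟨i, a⟩, b⟩ hx ⟨⟨k, a'⟩, b'⟩ hy hxy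
    simp only [Finset.coe_product, Set.mem_prod, Finset.mem_coe, Finset.mem_sigma] at hx hy
    obtain ⟨⟨hi, ha⟩, hb⟩ := hx
    obtain ⟨⟨hk, ha'⟩, hb'⟩ := hy
    simp only [f] at hxy
    -- the collision `a + b = a' + b'`, read as an equality of differences in class `k` / class `i`
    have e₁ : ∀ v : G, (v + b) - a' - ((v + b') - a) = (a + b) - (a' + b') := fun v => by abel
    have e₂ : ∀ v : G, (v + b') - a - ((v + b) - a') = -((a + b) - (a' + b')) := fun v => by abel
    rcases lt_trichotomy i k with hik | hik | hik
    · -- `i < k`: diagonal pair `(a', u k + b)` of class `k` against the cross pair `(a, u k + b')`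
      exact (hL k i k hik a' ha' (u k + b) (memY k hk b hb) a ha (u k + b') (memY k hk b' hb')
        (sub_eq_zero.1 (by rw [e₁, hxy, sub_self]))).elim
    · -- `i = k`: directness of the class
      subst hik
      have e : ∀ v : G, a - a' + (v + b - (v + b')) = (a + b) - (a' + b') := fun v => by abel
      obtain ⟨h1, h2⟩ := hW i a ha a' ha' (u i + b) (memY i hi b hb) (u i + b') (memY i hi b' hb')
        (by rw [e, hxy, sub_self])
      have hb2 : b = b' := add_left_cancel h2
      subst h1; subst hb2; rfl
    · -- `k < i`: diagonal pair `(a, u i + b')` of class `i` against the cross pair `(a', u i + b)`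
      exact (hL i k i hik a ha (u i + b') (memY i hi b' hb') a' ha' (u i + b) (memY i hi b hb)
        (sub_eq_zero.1 (by rw [e₂, hxy, sub_self, neg_zero]))).elim
  have := Finset.card_le_card_of_injOn f (fun _ _ => Finset.mem_univ _) hinj
  rwa [Finset.card_product, Finset.card_sigma, Finset.card_univ] at this

/-- **`K` right shapes pack `K` times (ladders).**  If the `Y`-sides of a ladder
`(X c, Y c)_{c < r}` are translates `u c +ᵥ Y₀ (κ c)` of at most `K` templates `Y₀ 0, …, Y₀ (K-1)`,
then
`Σ_c |X c| · |Y c| ≤ K · |G|`: on the fibre of `κ` over `k` the main theorem packs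
`(Σ |X c|) · |Y₀ k| ≤ |G|`. -/
theorem ladder_sum_card_mul_le_of_rightShapes {G : Type*} [AddCommGroup G] [Fintype G] [DecidableEq G]
    {r K : ℕ} (X Y : Fin r → Finset G)
    (hW : ∀ c : Fin r, ∀ x ∈ X c, ∀ x' ∈ X c, ∀ y ∈ Y c, ∀ y' ∈ Y c,
      (x - x') + (y - y') = 0 → x = x' ∧ y = y')
    (hL : ∀ c p q : Fin r, p < q → ∀ x ∈ X c, ∀ y ∈ Y c, ∀ x' ∈ X p, ∀ y' ∈ Y q, y - x ≠ y' - x')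
    (Y₀ : Fin K → Finset G) (κ : Fin r → Fin K) (u : Fin r → G) (hY : ∀ c, Y c = u c +ᵥ Y₀ (κ c)) :
    ∑ c, (X c).card * (Y c).card ≤ K * Fintype.card G := by
  have hcard : ∀ c, (Y c).card = (Y₀ (κ c)).card := fun c => by rw [hY c, Finset.card_vadd_finset]
  rw [← Finset.sum_fiberwise (Finset.univ : Finset (Fin r)) κ (fun c => (X c).card * (Y c).card)]
  have hclass : ∀ k : Fin K,
      ∑ c ∈ (Finset.univ : Finset (Fin r)).filter (fun c => κ c = k), (X c).card * (Y c).card ≤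
        Fintype.card G := by
    intro k
    have h1 :
        ∑ c ∈ (Finset.univ : Finset (Fin r)).filter (fun c => κ c = k), (X c).card * (Y c).card =
          (∑ c ∈ (Finset.univ : Finset (Fin r)).filter (fun c => κ c = k), (X c).card) *
            (Y₀ k).card := by
      rw [Finset.sum_mul]
      refine Finset.sum_congr rfl fun c hc => ?_
      rw [Finset.mem_filter] at hc
      rw [hcard c, hc.2]
    rw [h1]
    refine ladder_sum_card_mul_card_le_of_subshape X Y hW hL _ (Y₀ k) u fun c hc => ?_
    rw [Finset.mem_filter] at hc
    intro z hz
    rw [hY c, hc.2]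
    exact hz
  calc ∑ k : Fin K, ∑ c ∈ (Finset.univ : Finset (Fin r)).filter (fun c => κ c = k),
        (X c).card * (Y c).card
      ≤ ∑ _k : Fin K, Fintype.card G := Finset.sum_le_sum fun k _ => hclass k
    _ = K * Fintype.card G := by
      rw [Finset.sum_const, Finset.card_univ, Fintype.card_fin, smul_eq_mul]

end Summit.MatrixMultiplication.MatrixMultiplication.Theorems.PrimeTwoFamilies.LadderLift
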